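import Summits.BirchSwinnertonDyer.Rank1Residual.P2.CongruentNumberHalvingBitsTwoDescent
import Mathlib.Tactic.NormNum.IsSquare
import HarnessLib

/-!
# Sub-lane «bsd-p2»: the PER-PAIR KIT for the halving-bits door — square-class helpers, the group
# law of `E_n : y² = x³ − n²x` BY COORDINATES, and the coordinate-level assembly through
# `P2/CongruentNumberHalvingBitsTwoDescent.lean` (p352033 §4) — ONE shared file, no pair instantiated
# (0 def; 0 facts; 0 (K); no numeral of a census cell)

HONEST FRAMING (sub-lane «bsd-p2», run/shared/lean/b2b/bsd-rank1-residual/p2/, verbatim in every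
file): the target of record is the FULL Birch–Swinnerton-Dyer formula for EVERY analytic-rank `≤ 1`
`E/ℚ` at ALL primes INCLUDING `2`; the odd-prime class ledger is referee A's; the `2`-part is OPEN
(cells O1 = X5 ∖ CM and O12 = the CM corner) and under census by «bsd-p2». Census / instrument
output at `2` = EVIDENCE / conjecture items with held-out validation, NEVER a Literature fact;
certificates close PAIRS (one isogeny class, `p = 2`), never classes. THIS FILE is unconditional
algebra over `ℚ` from tree / Mathlib theorems: (§0) two square-class helpers («`a·b` a square ⟹ same
class», «`a·b` not a square ⟹ different classes»); (§1) Mathlib's group law on `E_n(ℚ)` EVALUATED ON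
COORDINATES — chord and tangent with the slope and the result SUPPLIED and checked by field identities
(`Affine.Point.add_of_X_ne` / `add_self_of_Y_ne`; the shape of `Supersingular/RationalLadder.lean` §1,
RE-STATED here for `E_n` so that a P2 per-pair file imports P2 + Literature + Mathlib + HarnessLib only —
p2-lead GEN 7 BATCH 42 rulings (i)/(ii)); (§2) the `b₁` witness («`δ s ∈ δ(E_n[2])`» from two rational
square roots) and the `¬ b₂` witness («`δ R₀ ∉ δ(E_n[2])`» from four non-square rationals) of p352033
§2–§3, packaged once; (§3) the COORDINATE-LEVEL ASSEMBLY: p352033 §4 with every group-theoretic input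
replaced by rational identities a per-pair file closes by `norm_num` / `decide`. It closes NO pair,
states no conjecture, adds no fact, touches no (K) / mark / tier; a pair assembled through §3 is still
«`BSD₂(E_n)` modulo the DISPLAYED `T_even(n)` hypothesis `hT` (PRINTED-ASSERTED: LEMMA (I)-even ∘
Tian–Yuan–Zhang Thm 3.3, never discharged in the tree), `hGZK`, `hMe`» — never unconditional.

THE PER-PAIR OBLIGATIONS LEFT BY §3 (all numerals, no group law, no `L`-numerics): the cell data
(`p` prime / injective, `2∏p = n`, `n % 8 = 6`, `s(n) = monskySelmerRankEven p = 1` by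
`monskySelmerRankEven_eq_of_table` + one `decide`); `s = (x_s, y_s)`, `R₀ = (x_R, y_R)` ON the curve
(`cn_nonsingular_iff` + `norm_num`), `y_s ≠ 0`, `y_R ≠ 0`; `2 • R₀ = s + T₀` by §1 (one tangent, plus one
chord when `T₀ ≠ O`); the `b₁` roots `(x_s + n)·c₁ = r₁²`, `x_s·c₂ = r₂²` for one torsion class
`(c₁, c₂)`; four non-square witnesses for `δ R₀ = (x_R + n, x_R)`; and the displayed `hT`.
Statements carry an arbitrary `DecidableEq ℚ` instance (`[inst : DecidableEq ℚ]`, tree idiom of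
`TwoDescentLinearConditions` / p352033). Cell `openO12` (CM, `2` ramified); nothing here is specific to
a cell numeral. Nothing booked; no mark moved. Unit `b2b-bsdres-p2-typer` GEN 17 (SCRATCH for the
lane's SWEEP item (ε′) under p2-lead GEN 7 BATCH 42 rulings (i) «generic square-class helpers in ONE
shared P2 file, never per pair» and (ii) «NO cross-cell import in a P2 exemplar / helper file»).
Coordinates: p352033 (discharge lemmas + §4 schema), p350663 (the door), p347324 (even `ℓ = 3` door).

References: [SilvermanAEC2009] Group Law Algorithm III.2.3, Prop. X.1.4; [Knapp1993] Lemma 4.20;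
[Monsky1990MockHeegner] Remark (3) (p. 67); [Miller2011LMS] Def. 1.1; HOME `p2/LEAD-OKS.md` § GEN 7
BATCH 42; `p2/REFEREE.md` l.415 (R-G19-59).
-/

noncomputable section

open WeierstrassCurve WeierstrassCurve.Affine WeierstrassCurve.Affine.Point
  Literature.NumberTheory.EllipticCurves Literature.NumberTheory.EllipticCurves.TwoDescentLocal
  Literature.NumberTheory.EllipticCurves.Rank1Residual
  Literature.NumberTheory.EllipticCurves.Rank1Residual.Typed
  Literature.NumberTheory.EllipticCurves.HeathBrown1994

set_option autoImplicit false

namespace Summit.BirchSwinnertonDyer.Rank1Residual.P2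

/-! ## §0 Square classes of rationals: equal from a square product, distinct from a non-square product -/

/-- `a·b = r²` with `a, b ≠ 0` ⟹ `a` and `b` have the same square class in `ℚˣ/ℚˣ²` — the shape of a
per-pair «square-root witness». [folklore] -/
theorem sqClass_eq_of_mul_eq_sq_rat {a b r : ℚ} (ha : a ≠ 0) (hb : b ≠ 0) (h : a * b = r ^ 2) :
    sqClass a = sqClass b := by
  have h1 : sqClass a * sqClass b = 1 := by rw [← sqClass_mul ha hb, h, sqClass_sq]
  calc sqClass a = sqClass a * (sqClass b * sqClass b) := by
        rw [SqUnits.mul_self, SqUnits.mul_one]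
    _ = sqClass a * sqClass b * sqClass b := by rw [mul_assoc]
    _ = sqClass b := by rw [h1, SqUnits.one_mul]

/-- `a·b` NOT a square with `a, b ≠ 0` ⟹ `a` and `b` have different square classes — the shape of a
per-pair «non-square witness» (decided on literals by `Mathlib.Tactic.NormNum.IsSquare`). [folklore] -/
theorem sqClass_ne_of_not_isSquare_mul {a b : ℚ} (ha : a ≠ 0) (hb : b ≠ 0)
    (h : ¬ IsSquare (a * b)) : sqClass a ≠ sqClass b := by
  intro he
  apply h
  have h1 : sqClass (a * b) = 1 := by rw [sqClass_mul ha hb, he, SqUnits.mul_self]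
  obtain ⟨u, hu⟩ := (sqClass_eq_one_iff (mul_ne_zero ha hb)).mp h1
  exact ⟨u, by rw [hu, sq]⟩

/-! (`a` not a square ⟹ `sqClass a ≠ 1` is the case `b = 1`; it is also the tree's
`Literature.Barriers.BirchSwinnertonDyer.curve480a1.sqClass_ne_one`, whose module is not imported into
the P2 cone — §2 below uses the `b = 1` instance of the lemma above instead of re-declaring it.) -/

/-! ## §1 The group law of `E_n(ℚ)` on coordinates: chord and tangent with supplied slope and result -/

section GroupLaw

variable [inst : DecidableEq ℚ] {n : ℕ}

omit inst in
/-- On `E_n` (`a₁ = a₃ = 0`): `−(x, y) = (x, −y)`, i.e. `negY x y = −y`. [folklore] -/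
theorem negY_congruentNumberCurve (x y : ℚ) : (congruentNumberCurve n).toAffine.negY x y = -y := by
  rw [negY, cn_affine_a₁, cn_affine_a₃]; ring

/-- **CHORD on `E_n` by coordinates.** If `x₁ ≠ x₂`, `L·(x₁ − x₂) = y₁ − y₂`, `x₃ = L² − x₁ − x₂` and
`y₃ = L·(x₁ − x₃) − y₁`, then `(x₁, y₁) + (x₂, y₂) = (x₃, y₃)` in `E_n(ℚ)` (Mathlib's
`Affine.Point.add_of_X_ne` with `slope = L`, `addX = L² + a₁L − a₂ − x₁ − x₂`, `addY`). Per pair the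
four hypotheses are rational identities closed by `norm_num`. [cite: SilvermanAEC2009, Group Law Algorithm III.2.3] -/
theorem some_add_some_congruentNumberCurve {x₁ y₁ x₂ y₂ x₃ y₃ : ℚ} (L : ℚ)
    (h₁ : (congruentNumberCurve n).toAffine.Nonsingular x₁ y₁)
    (h₂ : (congruentNumberCurve n).toAffine.Nonsingular x₂ y₂)
    (h₃ : (congruentNumberCurve n).toAffine.Nonsingular x₃ y₃)
    (hx : x₁ ≠ x₂) (hL : L * (x₁ - x₂) = y₁ - y₂) (hx₃ : x₃ = L ^ 2 - x₁ - x₂)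
    (hy₃ : y₃ = L * (x₁ - x₃) - y₁) :
    (Point.some x₁ y₁ h₁ : (congruentNumberCurve n).toAffine.Point) + Point.some x₂ y₂ h₂ =
      Point.some x₃ y₃ h₃ := by
  have hslope : (congruentNumberCurve n).toAffine.slope x₁ x₂ y₁ y₂ = L := by
    rw [slope_of_X_ne hx, div_eq_iff (sub_ne_zero.mpr hx), hL]
  rw [add_of_X_ne hx]
  have ex : (congruentNumberCurve n).toAffine.addX x₁ x₂ L = x₃ := by
    rw [addX, cn_affine_a₁, hx₃]; simp only [show (congruentNumberCurve n).toAffine.a₂ = 0 from rfl]; ring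
  have ey : (congruentNumberCurve n).toAffine.addY x₁ x₂ y₁ L = y₃ := by
    rw [addY, negAddY, negY_congruentNumberCurve, ex, hy₃]; ring
  simp only [hslope, ex, ey]

/-- **TANGENT on `E_n` by coordinates.** If `y₁ ≠ 0`, `L·(2y₁) = 3x₁² − n²`, `x₃ = L² − 2x₁` and
`y₃ = L·(x₁ − x₃) − y₁`, then `(x₁, y₁) + (x₁, y₁) = (x₃, y₃)` in `E_n(ℚ)` (Mathlib's
`Affine.Point.add_self_of_Y_ne`). [cite: SilvermanAEC2009, Group Law Algorithm III.2.3] -/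
theorem add_self_congruentNumberCurve {x₁ y₁ x₃ y₃ : ℚ} (L : ℚ)
    (h₁ : (congruentNumberCurve n).toAffine.Nonsingular x₁ y₁)
    (h₃ : (congruentNumberCurve n).toAffine.Nonsingular x₃ y₃)
    (hy : y₁ ≠ 0) (hL : L * (2 * y₁) = 3 * x₁ ^ 2 - (n : ℚ) ^ 2) (hx₃ : x₃ = L ^ 2 - 2 * x₁)
    (hy₃ : y₃ = L * (x₁ - x₃) - y₁) :
    (Point.some x₁ y₁ h₁ : (congruentNumberCurve n).toAffine.Point) + Point.some x₁ y₁ h₁ =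
      Point.some x₃ y₃ h₃ := by
  have hy' : y₁ ≠ (congruentNumberCurve n).toAffine.negY x₁ y₁ := by
    rw [negY_congruentNumberCurve]; intro h; apply hy; linarith
  have hD : y₁ - (congruentNumberCurve n).toAffine.negY x₁ y₁ = 2 * y₁ := by
    rw [negY_congruentNumberCurve]; ring
  have hslope : (congruentNumberCurve n).toAffine.slope x₁ x₁ y₁ y₁ = L := by
    rw [slope_of_Y_ne rfl hy', hD, div_eq_iff (mul_ne_zero two_ne_zero hy), cn_affine_a₁,
      show (congruentNumberCurve n).toAffine.a₂ = 0 from rfl,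
      show (congruentNumberCurve n).toAffine.a₄ = -((n : ℚ) ^ 2) from rfl, hL]
    ring
  rw [add_self_of_Y_ne hy']
  have ex : (congruentNumberCurve n).toAffine.addX x₁ x₁ L = x₃ := by
    rw [addX, cn_affine_a₁, hx₃]; simp only [show (congruentNumberCurve n).toAffine.a₂ = 0 from rfl]; ring
  have ey : (congruentNumberCurve n).toAffine.addY x₁ x₁ y₁ L = y₃ := by
    rw [addY, negAddY, negY_congruentNumberCurve, ex, hy₃]; ring
  simp only [hslope, ex, ey]

/-- **DOUBLING on `E_n` by coordinates**: the tangent lemma as `2 • (x₁, y₁) = (x₃, y₃)`.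
[cite: SilvermanAEC2009, Group Law Algorithm III.2.3] -/
theorem two_nsmul_some_congruentNumberCurve {x₁ y₁ x₃ y₃ : ℚ} (L : ℚ)
    (h₁ : (congruentNumberCurve n).toAffine.Nonsingular x₁ y₁)
    (h₃ : (congruentNumberCurve n).toAffine.Nonsingular x₃ y₃)
    (hy : y₁ ≠ 0) (hL : L * (2 * y₁) = 3 * x₁ ^ 2 - (n : ℚ) ^ 2) (hx₃ : x₃ = L ^ 2 - 2 * x₁)
    (hy₃ : y₃ = L * (x₁ - x₃) - y₁) :
    (2 : ℕ) • (Point.some x₁ y₁ h₁ : (congruentNumberCurve n).toAffine.Point) = Point.some x₃ y₃ h₃ := by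
  rw [two_nsmul]
  exact add_self_congruentNumberCurve L h₁ h₃ hy hL hx₃ hy₃

/-- On `E_n` (`n ≠ 0`): an affine point with `y ≠ 0` is not `2`-torsion (`2 • (x, y) ≠ O`) — the
door's `hs2` for an explicit `s`. [cite: Knapp1993, Lemma 4.20] -/
theorem two_nsmul_some_ne_zero_congruentNumberCurve (hn : n ≠ 0) {x y : ℚ}
    (h : (congruentNumberCurve n).toAffine.Nonsingular x y) (hy : y ≠ 0) :
    (2 : ℕ) • (Point.some x y h : (congruentNumberCurve n).toAffine.Point) ≠ 0 := by
  intro h2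
  rcases (two_nsmul_eq_zero_iff_congruentNumberCurve hn _).mp h2 with h0 | ⟨x', y', h', he, hy0⟩
  · exact Point.some_ne_zero _ h0
  · simp only [Point.some.injEq] at he
    exact hy (he.2.trans hy0)

/-- On `E_n` (`n ≠ 0`): an affine point `(x, 0)` IS `2`-torsion (`2 • (x, 0) = O`) — the door's `hT₀`
for an affine `T₀ ∈ {(−n, 0), (0, 0), (n, 0)}`. [cite: Knapp1993, Lemma 4.20] -/
theorem two_nsmul_some_zero_congruentNumberCurve (hn : n ≠ 0) {x : ℚ}
    (h : (congruentNumberCurve n).toAffine.Nonsingular x 0) :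
    (2 : ℕ) • (Point.some x 0 h : (congruentNumberCurve n).toAffine.Point) = 0 :=
  (two_nsmul_eq_zero_iff_congruentNumberCurve hn _).mpr (Or.inr ⟨_, _, _, rfl, rfl⟩)

omit inst in
/-- On `E_n` (`n ≠ 0`): `y ≠ 0` puts `x` off the `2`-torsion abscissae `−n` and `0` (indeed
`y² = (x + n)·x·(x − n)`), so `δ(x, y) = (x + n, x)` is read by
`twoDescentMap_some_congruentNumberCurve`. [folklore] -/
theorem ne_and_ne_of_y_ne_zero_congruentNumberCurve (hn : n ≠ 0) {x y : ℚ}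
    (h : (congruentNumberCurve n).toAffine.Nonsingular x y) (hy : y ≠ 0) :
    x ≠ -(n : ℚ) ∧ x ≠ 0 := by
  have he := (cn_nonsingular_iff hn x y).mp h
  constructor
  · rintro rfl; apply hy; have : y ^ 2 = 0 := by rw [he]; ring
    exact pow_eq_zero_iff (n := 2) (by norm_num) |>.mp this
  · rintro rfl; apply hy; have : y ^ 2 = 0 := by rw [he]; ring
    exact pow_eq_zero_iff (n := 2) (by norm_num) |>.mp this

end GroupLaw

/-! ## §2 The two descent witnesses on coordinates: `δ s ∈ δ(E_n[2])` (⟹ `b₁`), `δ R₀ ∉ δ(E_n[2])` (⟹ `¬ b₂`) -/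

section Witnesses

variable [inst : DecidableEq ℚ] {n : ℕ}

/-- **The `b₁` witness by two square roots.** For `s = (x, y) ∈ E_n(ℚ)` with `y ≠ 0` and one of the
four classes `(c₁, c₂) ∈ {(1, 1), (2n², −n), (n, −n²), (2n, n)}` of `δ(E_n[2])` (p352033 §2): if
`(x + n)·c₁ = r₁²` and `x·c₂ = r₂²` then `δ s = δ T` for some `T` with `2 • T = O`.
[cite: SilvermanAEC2009, Prop. X.1.4] [cite: Knapp1993, Lemma 4.20] -/
theorem exists_two_torsion_twoDescentMap_eq_of_mul_eq_sq (hn : n ≠ 0) {x y : ℚ}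
    (h : (congruentNumberCurve n).toAffine.Nonsingular x y) (hy : y ≠ 0) {c₁ c₂ : ℚ} (r₁ r₂ : ℚ)
    (hc : (c₁ = 1 ∧ c₂ = 1) ∨ (c₁ = 2 * (n : ℚ) ^ 2 ∧ c₂ = -(n : ℚ)) ∨
      (c₁ = (n : ℚ) ∧ c₂ = -(n : ℚ) ^ 2) ∨ (c₁ = 2 * (n : ℚ) ∧ c₂ = (n : ℚ)))
    (e₁ : (x + n) * c₁ = r₁ ^ 2) (e₂ : x * c₂ = r₂ ^ 2) :
    haveI := isElliptic_congruentNumberCurve hn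
    ∃ T : (congruentNumberCurve n).toAffine.Point, (2 : ℕ) • T = 0 ∧
      twoDescentMap (splitTwoTorsion_cn n) (Point.some x y h) = twoDescentMap (splitTwoTorsion_cn n) T := by
  haveI := isElliptic_congruentNumberCurve hn
  have hn' : (n : ℚ) ≠ 0 := by exact_mod_cast hn
  obtain ⟨hx₁, hx₂⟩ := ne_and_ne_of_y_ne_zero_congruentNumberCurve hn h hy
  have hxn : x + n ≠ 0 := by intro h0; apply hx₁; linarith
  have hc₁ : c₁ ≠ 0 := by
    rcases hc with ⟨rfl, -⟩ | ⟨rfl, -⟩ | ⟨rfl, -⟩ | ⟨rfl, -⟩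
    · exact one_ne_zero
    · exact mul_ne_zero two_ne_zero (pow_ne_zero 2 hn')
    · exact hn'
    · exact mul_ne_zero two_ne_zero hn'
  have hc₂ : c₂ ≠ 0 := by
    rcases hc with ⟨-, rfl⟩ | ⟨-, rfl⟩ | ⟨-, rfl⟩ | ⟨-, rfl⟩
    · exact one_ne_zero
    · exact neg_ne_zero.mpr hn'
    · exact neg_ne_zero.mpr (pow_ne_zero 2 hn')
    · exact hn'
  have k₁ : sqClass (x + n) = sqClass c₁ := sqClass_eq_of_mul_eq_sq_rat hxn hc₁ e₁
  have k₂ : sqClass x = sqClass c₂ := sqClass_eq_of_mul_eq_sq_rat hx₂ hc₂ e₂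
  rw [exists_two_torsion_twoDescentMap_eq_iff hn, twoDescentMap_some_congruentNumberCurve hn h hx₁ hx₂,
    k₁, k₂]
  rcases hc with ⟨rfl, rfl⟩ | ⟨rfl, rfl⟩ | ⟨rfl, rfl⟩ | ⟨rfl, rfl⟩
  · exact Or.inl (by rw [sqClass_one]; rfl)
  · exact Or.inr (Or.inl rfl)
  · exact Or.inr (Or.inr (Or.inl rfl))
  · exact Or.inr (Or.inr (Or.inr rfl))

/-- **The `¬ b₂` witness by four non-squares.** For `R₀ = (x, y) ∈ E_n(ℚ)` with `y ≠ 0`: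
`δ R₀ = (x + n, x)` avoids the four classes `(1, 1), (2n², −n), (n, −n²), (2n, n)` of `δ(E_n[2])` as
soon as, for each class `(c₁, c₂)`, `(x + n)·c₁` or `x·c₂` is not a rational square (one quadratic
character — a prime of odd valuation, or the sign — per class). [cite: SilvermanAEC2009, Prop. X.1.4]
[cite: Knapp1993, Lemma 4.20] -/
theorem forall_two_torsion_twoDescentMap_ne_of_not_isSquare (hn : n ≠ 0) {x y : ℚ}
    (h : (congruentNumberCurve n).toAffine.Nonsingular x y) (hy : y ≠ 0)
    (h1 : ¬ IsSquare (x + n) ∨ ¬ IsSquare x)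
    (h2 : ¬ IsSquare ((x + n) * (2 * (n : ℚ) ^ 2)) ∨ ¬ IsSquare (x * -(n : ℚ)))
    (h3 : ¬ IsSquare ((x + n) * (n : ℚ)) ∨ ¬ IsSquare (x * -(n : ℚ) ^ 2))
    (h4 : ¬ IsSquare ((x + n) * (2 * (n : ℚ))) ∨ ¬ IsSquare (x * (n : ℚ))) :
    haveI := isElliptic_congruentNumberCurve hn
    ∀ T : (congruentNumberCurve n).toAffine.Point, (2 : ℕ) • T = 0 →
      twoDescentMap (splitTwoTorsion_cn n) (Point.some x y h) ≠ twoDescentMap (splitTwoTorsion_cn n) T := by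
  haveI := isElliptic_congruentNumberCurve hn
  have hn' : (n : ℚ) ≠ 0 := by exact_mod_cast hn
  obtain ⟨hx₁, hx₂⟩ := ne_and_ne_of_y_ne_zero_congruentNumberCurve hn h hy
  have hxn : x + n ≠ 0 := by intro h0; apply hx₁; linarith
  intro T hT he
  have h4' := (exists_two_torsion_twoDescentMap_eq_iff hn (Point.some x y h)).mp ⟨T, hT, he⟩
  rw [twoDescentMap_some_congruentNumberCurve hn h hx₁ hx₂] at h4'
  have key : ∀ {a b c d : ℚ}, Additive.ofMul (sqClass a, sqClass b) =
      Additive.ofMul (sqClass c, sqClass d) → sqClass a = sqClass c ∧ sqClass b = sqClass d :=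
    fun h => Prod.mk.inj (Additive.ofMul.injective h)
  have key1 : ∀ {a b : ℚ}, Additive.ofMul (sqClass a, sqClass b) = 0 → sqClass a = 1 ∧ sqClass b = 1 :=
    fun h => Prod.mk.inj (Additive.ofMul.injective (h.trans ofMul_one.symm))
  rcases h4' with e | e | e | e
  · obtain ⟨ea, eb⟩ := key1 e
    rcases h1 with h1 | h1
    · exact sqClass_ne_of_not_isSquare_mul hxn one_ne_zero (by rwa [mul_one]) (by rwa [sqClass_one])
    · exact sqClass_ne_of_not_isSquare_mul hx₂ one_ne_zero (by rwa [mul_one]) (by rwa [sqClass_one])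
  · obtain ⟨ea, eb⟩ := key e
    rcases h2 with h2 | h2
    · exact sqClass_ne_of_not_isSquare_mul hxn (mul_ne_zero two_ne_zero (pow_ne_zero 2 hn')) h2 ea
    · exact sqClass_ne_of_not_isSquare_mul hx₂ (neg_ne_zero.mpr hn') h2 eb
  · obtain ⟨ea, eb⟩ := key e
    rcases h3 with h3 | h3
    · exact sqClass_ne_of_not_isSquare_mul hxn hn' h3 ea
    · exact sqClass_ne_of_not_isSquare_mul hx₂ (neg_ne_zero.mpr (pow_ne_zero 2 hn')) h3 eb
  · obtain ⟨ea, eb⟩ := key e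
    rcases h4 with h4 | h4
    · exact sqClass_ne_of_not_isSquare_mul hxn (mul_ne_zero two_ne_zero hn') h4 ea
    · exact sqClass_ne_of_not_isSquare_mul hx₂ hn' h4 eb

end Witnesses

/-! ## §3 Coordinate-level assembly through p352033 §4 (no pair instantiated here) -/

section Assembly

variable [inst : DecidableEq ℚ]

/-- **COORDINATE-LEVEL ASSEMBLY (even `ℓ = 3`; modulo `hGZK`, `hMe` and the DISPLAYED `hT`).**
p352033 §4 (`rankOne_sha_bsdp_two_of_twoDescent_congruentNumberCurve_two_mul_three_primes`) with its
group-theoretic inputs supplied from coordinates: the cell data (`n = 2p₀p₁p₂ ≡ 6 (mod 8)`, distinct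
primes, `s(n) = monskySelmerRankEven p = 1`); an explicit `s = (x_s, y_s) ∈ E_n(ℚ)` with `y_s ≠ 0`; the
displayed `T_even` hypothesis `hT : L′(E_n, 1) = 4·Ω·ĥ(s)`; the `b₁` witness = one torsion class
`(c₁, c₂)` and two roots with `(x_s + n)·c₁ = r₁²`, `x_s·c₂ = r₂²` (§2); ONE half `R₀ = (x_R, y_R)`,
`y_R ≠ 0`, of `s + T₀` for a `2`-torsion `T₀` (`hR₀ : 2 • R₀ = s + T₀`, closed per pair by §1); and four
non-square witnesses putting `δ R₀ = (x_R + n, x_R)` outside `δ(E_n[2])` (§2). THEN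
`ord_{s=1} L(E_n, s) = 1`, rank `1`, `Ш(E_n)[2^∞] = 0` and `BSD(E_n, 2)`. CONDITIONAL on `hT`
(PRINTED-ASSERTED, never discharged in the tree): a pair closed this way is «`BSD₂(E_n)` modulo
`T_even(n)`, GZK, Monsky's even matrix theorem», nothing more; closes NO class; no numeral of a census
cell appears in this file. [cite: Monsky1990MockHeegner, Remark (3) (p. 67)]
[cite: SilvermanAEC2009, Prop. X.1.4] [cite: Miller2011LMS, Def. 1.1 (arXiv:1010.2431 p. 3)] -/
theorem rankOne_sha_bsdp_two_of_coordinates_congruentNumberCurve_two_mul_three_primes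
    (hGZK : rank_eq_analyticRank_of_analyticRank_le_one) (hMe : monsky_card_selmerGroup_two_even)
    (p : Fin 3 → ℕ) (hp : ∀ i, (p i).Prime) (hinj : Function.Injective p) {n : ℕ}
    (hn : 2 * ∏ i, p i = n) (h8 : n % 8 = 6) (hs : monskySelmerRankEven p = 1) (hn0 : n ≠ 0)
    {xs ys : ℚ} (hs_on : (congruentNumberCurve n).toAffine.Nonsingular xs ys) (hys : ys ≠ 0)
    (hT : deriv (congruentNumberCurve n).entireLFunction 1 =
      (4 : ℂ) * ((congruentNumberCurve n).realPeriodRat : ℂ) *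
        ((Point.some xs ys hs_on : (congruentNumberCurve n).toAffine.Point).canonicalHeight : ℂ))
    {c₁ c₂ : ℚ} (r₁ r₂ : ℚ)
    (hc : (c₁ = 1 ∧ c₂ = 1) ∨ (c₁ = 2 * (n : ℚ) ^ 2 ∧ c₂ = -(n : ℚ)) ∨
      (c₁ = (n : ℚ) ∧ c₂ = -(n : ℚ) ^ 2) ∨ (c₁ = 2 * (n : ℚ) ∧ c₂ = (n : ℚ)))
    (e₁ : (xs + n) * c₁ = r₁ ^ 2) (e₂ : xs * c₂ = r₂ ^ 2)
    {xR yR : ℚ} (hR_on : (congruentNumberCurve n).toAffine.Nonsingular xR yR) (hyR : yR ≠ 0)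
    (T₀ : (congruentNumberCurve n).toAffine.Point) (hT₀ : (2 : ℕ) • T₀ = 0)
    (hR₀ : (2 : ℕ) • (Point.some xR yR hR_on : (congruentNumberCurve n).toAffine.Point) =
      Point.some xs ys hs_on + T₀)
    (h1 : ¬ IsSquare (xR + n) ∨ ¬ IsSquare xR)
    (h2 : ¬ IsSquare ((xR + n) * (2 * (n : ℚ) ^ 2)) ∨ ¬ IsSquare (xR * -(n : ℚ)))
    (h3 : ¬ IsSquare ((xR + n) * (n : ℚ)) ∨ ¬ IsSquare (xR * -(n : ℚ) ^ 2))
    (h4 : ¬ IsSquare ((xR + n) * (2 * (n : ℚ))) ∨ ¬ IsSquare (xR * (n : ℚ))) :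
    (congruentNumberCurve n).analyticRank = 1 ∧ (congruentNumberCurve n).mordellWeilRank = 1 ∧
      AddCommGroup.primaryComponent (congruentNumberCurve n).sha 2 = ⊥ ∧
      BSDp (congruentNumberCurve n) 2 := by
  obtain ⟨T₁, hT₁, hδ₁⟩ := exists_two_torsion_twoDescentMap_eq_of_mul_eq_sq hn0 hs_on hys r₁ r₂ hc e₁ e₂
  exact rankOne_sha_bsdp_two_of_twoDescent_congruentNumberCurve_two_mul_three_primes hGZK hMe p hp hinj
    hn h8 hs hn0 (Point.some xs ys hs_on) (two_nsmul_some_ne_zero_congruentNumberCurve hn0 hs_on hys) hT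
    T₁ hT₁ hδ₁ (Point.some xR yR hR_on) T₀ hT₀ hR₀
    (forall_two_torsion_twoDescentMap_ne_of_not_isSquare hn0 hR_on hyR h1 h2 h3 h4)

end Assembly

end Summit.BirchSwinnertonDyer.Rank1Residual.P2

end
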